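import Literature.Analysis.FluidPDE.LerayHopfTimeSlice
import Literature.Analysis.FluidPDE.HelmholtzAnnihilator
import Literature.Analysis.FluidPDE.LerayProjector
import Literature.Analysis.FunctionSpaces.DuBoisReymondAE
import Mathlib.MeasureTheory.Measure.SeparableMeasure
import HarnessLib

/-!
# Weak solutions in `L^∞(0,T; L²)` are weakly `L²`-continuous after redefinition

Analysis/FluidPDE support file in the decomposition of `Literature.Analysis.FluidPDE.galdi_energy_equality`
(Galdi 2018, Thm. 1.1; see `FluidPDE/NSGaldiEnergyEquality`), serving its second layer
`Literature.Analysis.FluidPDE.lions_energy_equality_L4` — the energy equality for weak solutions of the unforced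
Navier–Stokes system on `ℝ³` in the energy class `L^∞(0,T; L²) ∩ L²(0,T; H¹)` which lie in
`L⁴(0,T; L⁴)` (J.-L. Lions 1960; Shinbrot 1974; Sohr 2001, Ch. V, Thm. 1.4.1). The printed proofs
(Serrin 1963, §4, "doubling of the time variable"; Sohr, proof of Thm. IV.2.3.1/V.1.4.1) use the
solution as a test function at **every** time, which presupposes the classical first step
"*after a redefinition on a null set of `[0,T)`, `u : [0,T) → L²_σ` is weakly continuous with
`u(0) = u₀`*" (Sohr 2001, Ch. V, Thm. 1.3.1; Galdi 2000, Lemma 2.2; Temam 1977, Ch. III, §3).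
The accepted Leray–Hopf predicate `Fluid.IsLerayHopfOn` carries weak continuity as a field; a
mere weak solution `Fluid.IsWeakNSSolutionOn` in `L^∞(0,T; L²)` — the hypothesis of
`lions_energy_equality_L4` and the output of Galdi's class assertion — does not, and this file
supplies it.

## Main results (all proved)

* `Fluid.IsWeakNSSolutionOn.exists_weaklyContinuousOn_version` — for a weak solution `u` of the
  unforced system on `E × [0, T)` (`E` a finite-dimensional real inner product space, `T > 0`)
  with `u ∈ L^∞(0, T; L²)` (guarded mixed class `Fluid.MemLqLp ∞ 2 u (Ioo 0 T)`) and datum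
  `u₀ ∈ L²`, weakly divergence free, there is `v` with `v t = u t` for a.e. `t ∈ (0,T)`,
  `v 0 = u₀`, every slice `v t`, `t ∈ [0,T]`, in `L²` with `‖v t‖₂ ≤ ‖u‖_{L^∞(0,T;L²)}` and
  weakly divergence free (so `v t ∈ L²_σ` at **every** `t`), `v` again a weak solution with
  datum `u₀`, and `t ↦ ∫ ⟪v t, w⟫` continuous on `[0, T]` for every `w ∈ L²(E; E)` (not only
  for solenoidal `w`: the gradient part of the pairing vanishes identically). No gradient bound
  `∇u ∈ L²L²` is needed.
* `Fluid.IsWeakNSSolutionOn.ae_inner_test_eq` — the time-sliced weak formulation for a.e. `t`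
  (Galdi 2000, Lemma 2.1; Serrin 1963, (6)), from the accepted a.e. du Bois-Reymond lemma;
  `Fluid.IsWeakNSSolutionOn.inner_test_eq_of_continuousOn` — the same at **every** `t ∈ [0,T]`
  once the pairing is continuous (so for the representative `v`).
* Glue of independent interest: `Literature.Analysis.FluidPDE.exists_forall_tendsto_inner_of_dense_span` (weak limits in
  a Hilbert space from convergence of the pairings against a set with dense span, for bounded
  families; `ε/3` + Riesz), `Literature.Analysis.FluidPDE.continuousOn_inner_of_dense_span`,
  `Literature.Analysis.FluidPDE.eq_of_forall_inner_eq_of_dense_span`, and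
  `Fluid.dense_span_solenoidalOrGradient` — **the classes of divergence-free test fields and of
  test gradients span a dense subspace of `L²(E; E)`** (trivial orthogonal complement by the
  accepted annihilator lemma `IsWeaklyDivFree.ae_eq_zero_of_memLp_of_forall_integral_inner_eq_zero`,
  `FluidPDE/HelmholtzAnnihilator`; this is the density half of the Helmholtz–Weyl decomposition
  `L² = L²_σ ⊕ G`, Sohr 2001, Lemma II.2.5.1, Temam 1977, Ch. I, Thm. 1.4).

## Proof of the main result

Choose a countable family `D₀` of generators (classes of divergence-free test fields `φ` and of
test gradients `∇q`) with the same closure as all of them (`L²` is second countable: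
Mathlib's `MeasureTheory.Lp.SecondCountableTopology` for the separable Lebesgue measure), hence
with dense span. Each pairing `t ↦ ⟨u(t), d⟩`, `d ∈ D₀`, agrees for a.e. `t` with a function
`g_d` continuous on `[0,T]` with `g_d(0) = ⟨u₀, d⟩`: `⟨u₀, φ⟩ + ∫_{(0,t]} ∫(⟪u,(u·∇)φ⟫ + ν⟪u,Δφ⟫)`
by the a.e. slice identity, resp. `0` (the slices and `u₀` are weakly divergence free). On a
conull measurable good set `S ⊆ (0,T)` all these identities hold and `‖u(t)‖₂ ≤ ‖u‖_{L^∞L²}`;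
`S` is dense in `[0,T]`. At every `t₀ ∈ [0,T]` the bounded family of classes `[u(t)]`, `t → t₀`
within `S`, has convergent pairings against `D₀`, hence (abstract lemma) a weak limit `Y(t₀)`,
`‖Y(t₀)‖ ≤ ‖u‖_{L^∞L²}`, with `⟨Y(t₀), d⟩ = g_d(t₀)`; so `Y = [u]` on `S`, `Y(0) = [u₀]`
(pairings against `D₀` determine a vector), and `t ↦ Y(t)` is weakly continuous on `[0,T]`
(uniform approximation). The representative is `u` on `S`, `u₀` at `0`, and the canonical
representative of `Y(t)` elsewhere; it is again a weak solution because every clause of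
`IsWeakNSSolutionOn` sees the slices only a.e. in time (`IsWeakNSSolutionOn.congr_ae_slice`).

## Mathlib search

Mathlib (this pin) has the Riesz representation (`InnerProductSpace.toDual`), closed kernels,
`Submodule.topologicalClosure_eq_top_iff` (dense iff trivial orthogonal complement),
`cauchy_map_iff_exists_tendsto`, `TendstoUniformlyOn.continuousOn`, second countability of `L^p`
for separable measures (`MeasureTheory.Lp.SecondCountableTopology`, `Measure/SeparableMeasure`),
`IsSeparable.exists_countable_dense_subset`, and the fundamental lemma of the calculus of
variations; it has no weak formulations of evolution PDE and no "weakly continuous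
representative" statement (searched `weakly continuous`, `WeakSpace` + `ae`, `representative` in
`MeasureTheory/Function`, `Analysis/InnerProductSpace`). From the tree: the product-test and
du Bois-Reymond toolkit (`LerayHopfTimeSlice`, `DuBoisReymond`, `DuBoisReymondAE`), the mixed
classes (`LerayHopf`, `LerayHopfProofs`), the annihilator lemma (`HelmholtzAnnihilator`), the
solenoidal space `solenoidalL2 E` with its generators `smoothSolenoidal E`, the gradient space
`gradientRange E` and the named Helmholtz fact `orthogonal_solenoidalL2_eq_gradientRange`
(`LerayProjector`, `SolenoidalL2Duality`; `dense_span_solenoidalOrGradient` below is its density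
half, proved), and the sequential weak-limit lemmas
`Literature.Analysis.FunctionSpaces.exists_mem_tendsto_inner_of_subset_closure_span`,
`Literature.Analysis.FunctionSpaces.norm_le_of_tendsto_inner_of_eventually_norm_le` (`FunctionSpaces/DiagonalWeakLimits`),
generalised here to filters.

## References

* H. Sohr, *The Navier–Stokes Equations. An Elementary Functional Analytic Approach*,
  Birkhäuser 2001, Ch. V, Thm. 1.3.1 (weak continuity after redefinition, with `u(0) = u₀`),
  Thm. 1.4.1 (energy equality); Ch. II, Lemma 2.5.1 (Helmholtz decomposition) (`Sohr2001`).
* G. P. Galdi, *An introduction to the Navier–Stokes initial-boundary value problem*, in: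
  Fundamental Directions in Mathematical Fluid Mechanics, Birkhäuser 2000, Lemma 2.1, Lemma 2.2
  (`Galdi2000`).
* J. Serrin, *The initial value problem for the Navier–Stokes equations*, in: Nonlinear Problems
  (Madison 1962), Univ. Wisconsin Press 1963, §§3–4 (`Serrin1963`).
* R. Temam, *Navier–Stokes Equations*, North-Holland 1977, Ch. I, Thm. 1.4 (Helmholtz), Ch. III
  (weak continuity of weak solutions) (`Temam1977`).
* G. P. Galdi, *On the energy equality for distributional solutions to Navier–Stokes
  equations*, Proc. AMS 147 (2019), Thm. 1.1 (`Galdi2018`; the fact served).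
-/

noncomputable section

open MeasureTheory TopologicalSpace Set Function Filter Topology InnerProductSpace
open scoped RealInnerProductSpace ENNReal NNReal Laplacian ContDiff

namespace Literature.Analysis.FluidPDE

/-! ### Weak limits in a Hilbert space from convergence of a dense set of pairings -/

section Hilbert

variable {H : Type*} [NormedAddCommGroup H] [InnerProductSpace ℝ H] [CompleteSpace H]

/-- **Weak limits from a dense set of pairings.** Let `x : ι → H` be bounded by `M` along a
non-trivial filter `l`, and let `D ⊆ H` have dense linear span. If for every `v ∈ D` the
pairings `⟪x i, v⟫` converge along `l`, then there is `y ∈ H`, `‖y‖ ≤ M`, with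
`⟪x i, v⟫ → ⟪y, v⟫` along `l` for **every** `v ∈ H` (a bounded linear functional is defined by
the limits — they exist on the closure of the span by an `ε/3` argument — and is represented by
Riesz' theorem). Filter-indexed generalisation of the accepted sequential statements
`Literature.Analysis.FunctionSpaces.exists_mem_tendsto_inner_of_subset_closure_span` (with `K = ⊤`, `l = atTop`) and
`Literature.Analysis.FunctionSpaces.norm_le_of_tendsto_inner_of_eventually_norm_le` (`FunctionSpaces/DiagonalWeakLimits`); the
filter `𝓝[S] t₀` is needed below. [folklore] -/
theorem exists_forall_tendsto_inner_of_dense_span {ι : Type*} {l : Filter ι} [l.NeBot]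
    {x : ι → H} {M : ℝ} (hM : ∀ᶠ i in l, ‖x i‖ ≤ M) {D : Set H}
    (hD : Dense ((Submodule.span ℝ D : Submodule ℝ H) : Set H))
    (hconv : ∀ v ∈ D, ∃ L : ℝ, Tendsto (fun i => ⟪x i, v⟫) l (𝓝 L)) :
    ∃ y : H, ‖y‖ ≤ M ∧ ∀ v : H, Tendsto (fun i => ⟪x i, v⟫) l (𝓝 ⟪y, v⟫) := by
  have hM0 : 0 ≤ M := by
    obtain ⟨i, hi⟩ := hM.exists
    exact (norm_nonneg _).trans hi
  -- the set of good vectors is a closed submodule containing `D`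
  let V : Submodule ℝ H :=
    { carrier := {v | ∃ L : ℝ, Tendsto (fun i => ⟪x i, v⟫) l (𝓝 L)}
      add_mem' := by
        rintro v w ⟨Lv, hv⟩ ⟨Lw, hw⟩
        refine ⟨Lv + Lw, ?_⟩
        simpa only [inner_add_right] using hv.add hw
      zero_mem' := ⟨0, by simp⟩
      smul_mem' := by
        rintro c v ⟨Lv, hv⟩
        refine ⟨c * Lv, ?_⟩
        simpa only [real_inner_smul_right] using hv.const_mul c }
  have hDV : D ⊆ V := fun v hv => hconv v hv
  have hspan : (Submodule.span ℝ D : Submodule ℝ H) ≤ V := Submodule.span_le.2 hDV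
  have hclosed : IsClosed (V : Set H) := by
    refine isClosed_of_closure_subset fun v hv => ?_
    -- Cauchy criterion along `l`
    have hcau : Cauchy (map (fun i => ⟪x i, v⟫) l) := by
      refine Metric.cauchy_iff.2 ⟨inferInstance, fun ε hε => ?_⟩
      have hδ : 0 < ε / (4 * (M + 1)) := by positivity
      obtain ⟨v', hv'V, hvv'⟩ := Metric.mem_closure_iff.1 hv (ε / (4 * (M + 1))) hδ
      obtain ⟨L', hL'⟩ : ∃ L' : ℝ, Tendsto (fun i => ⟪x i, v'⟫) l (𝓝 L') := hv'V
      have hε4 : 0 < ε / 4 := by positivity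
      have h1 : ∀ᶠ i in l, dist ⟪x i, v'⟫ L' < ε / 4 := Metric.tendsto_nhds.1 hL' _ hε4
      refine ⟨(fun i => ⟪x i, v⟫) '' {i | dist ⟪x i, v'⟫ L' < ε / 4 ∧ ‖x i‖ ≤ M},
        image_mem_map (h1.and hM), ?_⟩
      rintro _ ⟨i, ⟨hi1, hi2⟩, rfl⟩ _ ⟨j, ⟨hj1, hj2⟩, rfl⟩
      have hclose : ∀ k, ‖x k‖ ≤ M → |⟪x k, v⟫ - ⟪x k, v'⟫| ≤ M * (ε / (4 * (M + 1))) := by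
        intro k hk
        rw [← inner_sub_right]
        calc |⟪x k, v - v'⟫| ≤ ‖x k‖ * ‖v - v'‖ := abs_real_inner_le_norm _ _
          _ ≤ M * (ε / (4 * (M + 1))) := by
              gcongr
              rw [← dist_eq_norm]; exact hvv'.le
      have hMε : M * (ε / (4 * (M + 1))) ≤ ε / 4 := by
        rw [mul_div_assoc', div_le_div_iff₀ (by positivity) (by positivity)]
        nlinarith
      rw [Real.dist_eq] at hi1 hj1 ⊢
      have := hclose i hi2
      have := hclose j hj2
      rw [abs_sub_lt_iff] at hi1 hj1 ⊢
      rw [abs_le] at *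
      constructor <;> linarith
    exact (cauchy_map_iff_exists_tendsto.1 hcau)
  have hVtop : (V : Set H) = univ := by
    have hdense : Dense (V : Set H) := hD.mono hspan
    rw [← hclosed.closure_eq, hdense.closure_eq]
  have hall : ∀ v : H, ∃ L : ℝ, Tendsto (fun i => ⟪x i, v⟫) l (𝓝 L) := fun v => by
    have : v ∈ (V : Set H) := by rw [hVtop]; exact mem_univ v
    exact this
  -- the limit functional
  choose Lf hLf using hall
  have hLadd : ∀ v w, Lf (v + w) = Lf v + Lf w := fun v w =>
    tendsto_nhds_unique (hLf (v + w)) (by simpa only [inner_add_right] using (hLf v).add (hLf w))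
  have hLsmul : ∀ (c : ℝ) v, Lf (c • v) = c * Lf v := fun c v =>
    tendsto_nhds_unique (hLf (c • v))
      (by simpa only [real_inner_smul_right] using (hLf v).const_mul c)
  have hLbound : ∀ v, |Lf v| ≤ M * ‖v‖ := fun v => by
    refine le_of_tendsto ((continuous_abs.tendsto _).comp (hLf v)) ?_
    filter_upwards [hM] with i hi
    exact (abs_real_inner_le_norm _ _).trans (by gcongr)
  let Lℓ : H →ₗ[ℝ] ℝ :=
    { toFun := Lf
      map_add' := hLadd
      map_smul' := fun c v => by simpa using hLsmul c v }
  let Lc : H →L[ℝ] ℝ := Lℓ.mkContinuous M fun v => by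
    rw [Real.norm_eq_abs]; exact hLbound v
  have hLc : ∀ v, Lc v = Lf v := fun v => rfl
  have hLc_norm : ‖Lc‖ ≤ M := Lℓ.mkContinuous_norm_le hM0 _
  refine ⟨(InnerProductSpace.toDual ℝ H).symm Lc, ?_, fun v => ?_⟩
  · simpa using hLc_norm
  · rw [InnerProductSpace.toDual_symm_apply, hLc]
    exact hLf v

end Hilbert

/-! ### The `L²` classes of divergence-free test fields and of test gradients span a dense subspace -/

section Fluid

variable {E : Type*} [NormedAddCommGroup E] [InnerProductSpace ℝ E] [FiniteDimensional ℝ E]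
  [MeasurableSpace E] [BorelSpace E]

/-- The gradient of a real test function is a compactly supported continuous field, hence in
every `L^p`. [folklore] -/
theorem _root_.Literature.Analysis.FunctionSpaces.IsTestFunctionOn.memLp_gradient {q : E → ℝ}
    (hq : FunctionSpaces.IsTestFunctionOn (⊤ : Opens E) q) (p : ℝ≥0∞) :
    MemLp (gradient q) p (volume : Measure E) := by
  refine (continuous_gradient_of_contDiff (hq.contDiff.of_le (by simp))).memLp_of_hasCompactSupport ?_
  exact hq.hasCompactSupport.mono' fun x hx => by
    by_contra h
    exact hx (gradient_eq_zero_of_notMem_tsupport h)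

variable (E) in
/-- The `L²` classes of gradients of real test functions, `{∇q | q ∈ C_c^∞(E; ℝ)}`: the
generating set of the accepted space of `L²` gradients `Fluid.gradientRange E`
(`FluidPDE/LerayProjector`, the closure of its span), named here because the weak-continuity
argument pairs against the generators themselves (Temam 1977, Ch. I, Thm. 1.4 and Rem. 1.6). [cite: Temam1977, Ch. I Thm. 1.4 and Rem. 1.6] -/
def testGradients : Set (Lp E 2 (volume : Measure E)) :=
  {v | ∃ q : E → ℝ, FunctionSpaces.IsTestFunctionOn (⊤ : Opens E) q ∧ (v : E → E) =ᵐ[volume] gradient q}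

/-- `gradientRange E` is the closed span of `testGradients E` (definitional). [cite: Temam1977, Ch. I Thm. 1.4 and Rem. 1.6] -/
theorem gradientRange_eq_topologicalClosure_span_testGradients :
    gradientRange E = (Submodule.span ℝ (testGradients E)).topologicalClosure := rfl

variable (E) in
/-- The generators of both summands of the Helmholtz–Weyl decomposition `L²(E;E) = L²_σ ⊕ G`:
the accepted set `Fluid.smoothSolenoidal E` (`FluidPDE/LerayProjector`: `L²` classes with a
smooth compactly supported divergence-free representative, generating `solenoidalL2 E`) together
with the test gradients `testGradients E` (generating `gradientRange E`) (Temam 1977, Ch. I,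
Thm. 1.4 and Rem. 1.6; Sohr 2001, Lemma II.2.5.1). [cite: Temam1977, Ch. I Thm. 1.4 and Rem. 1.6] -/
def solenoidalOrGradient : Set (Lp E 2 (volume : Measure E)) :=
  smoothSolenoidal E ∪ testGradients E

/-- The class of a divergence-free test field is a generator (it lies in `smoothSolenoidal E`). [cite: Temam1977, Ch. I Thm. 1.4 and Rem. 1.6] -/
theorem toLp_mem_solenoidalOrGradient {φ : E → E} (hφ : FunctionSpaces.IsTestFunctionOn (⊤ : Opens E) φ)
    (hdiv : VectorCalculus.IsDivFree φ) :
    (hφ.memLp_volume 2).toLp φ ∈ solenoidalOrGradient E :=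
  Or.inl (show (hφ.memLp_volume 2).toLp φ ∈ smoothSolenoidal E from ⟨φ, hφ, hdiv, MemLp.coeFn_toLp _⟩)

/-- The class of a test gradient is a generator (it lies in `testGradients E`). [cite: Temam1977, Ch. I Thm. 1.4 and Rem. 1.6] -/
theorem toLp_gradient_mem_solenoidalOrGradient {q : E → ℝ} (hq : FunctionSpaces.IsTestFunctionOn (⊤ : Opens E) q) :
    (hq.memLp_gradient 2).toLp (gradient q) ∈ solenoidalOrGradient E :=
  Or.inr (show (hq.memLp_gradient 2).toLp (gradient q) ∈ testGradients E from ⟨q, hq, MemLp.coeFn_toLp _⟩)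

/-- **The span of `C_{c,σ}^∞ ∪ ∇C_c^∞` is dense in `L²(E; E)`.** A class orthogonal to all test
gradients is weakly divergence free, and if it is also orthogonal to all divergence-free test
fields it vanishes by the annihilator lemma (uniqueness in the Helmholtz–Weyl decomposition,
accepted `IsWeaklyDivFree.ae_eq_zero_of_memLp_of_forall_integral_inner_eq_zero`); a subspace
with trivial orthogonal complement is dense (Temam 1977, Ch. I, Thm. 1.4 / Rem. 1.6;
Sohr 2001, Lemma II.2.5.1–2.5.4). This is the density half of the Helmholtz–Weyl decomposition,
vendored in the tree as the named fact `Fluid.orthogonal_solenoidalL2_eq_gradientRange`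
(`FluidPDE/LerayProjector`; see also `FluidPDE/SolenoidalL2Duality`). [cite: Temam1977, Ch. I Thm. 1.4 and Rem. 1.6] -/
theorem dense_span_solenoidalOrGradient :
    Dense ((Submodule.span ℝ (solenoidalOrGradient E) :
      Submodule ℝ (Lp E 2 (volume : Measure E))) : Set (Lp E 2 (volume : Measure E))) := by
  rw [Submodule.dense_iff_topologicalClosure_eq_top, Submodule.topologicalClosure_eq_top_iff,
    Submodule.eq_bot_iff]
  intro z hz
  have horth : ∀ v ∈ solenoidalOrGradient E, ⟪v, z⟫ = 0 := fun v hv =>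
    Submodule.inner_right_of_mem_orthogonal (Submodule.subset_span hv) hz
  have hz2 : MemLp (z : E → E) 2 volume := Lp.memLp z
  -- pairing of `z` with an `L²` representative
  have hpair : ∀ {g : E → E} (hg : MemLp g 2 volume), ⟪hg.toLp g, z⟫ = ∫ x, ⟪(z : E → E) x, g x⟫ := by
    intro g hg
    rw [L2.inner_def]
    refine integral_congr_ae ?_
    filter_upwards [hg.coeFn_toLp] with x hx
    rw [hx, real_inner_comm]
  have hdiv : IsWeaklyDivFree (z : E → E) := fun q hq => by
    rw [← hpair (hq.memLp_gradient 2)]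
    exact horth _ (toLp_gradient_mem_solenoidalOrGradient hq)
  have hsol : ∀ φ : E → E, FunctionSpaces.IsTestFunctionOn (⊤ : Opens E) φ → VectorCalculus.IsDivFree φ →
      ∫ x, ⟪(z : E → E) x, φ x⟫ = 0 := fun φ hφ hφd => by
    rw [← hpair (hφ.memLp_volume 2)]
    exact horth _ (toLp_mem_solenoidalOrGradient hφ hφd)
  have h0 := IsWeaklyDivFree.ae_eq_zero_of_memLp_of_forall_integral_inner_eq_zero
    ENNReal.one_lt_two ENNReal.ofNat_lt_top hz2 hdiv hsol
  exact (Lp.eq_zero_iff_ae_eq_zero).2 h0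

/-- The generators form a separable set of `L²(E; E)` (Lebesgue measure on a finite-dimensional
space is a separable measure, so `L²` is second countable), hence contain a countable subset
with the same closure. [folklore] -/
theorem exists_countable_dense_solenoidalOrGradient :
    ∃ D₀ ⊆ solenoidalOrGradient E, D₀.Countable ∧ solenoidalOrGradient E ⊆ closure D₀ := by
  haveI : Fact ((2 : ℝ≥0∞) ≠ ⊤) := ⟨ENNReal.ofNat_ne_top⟩
  have hsep : IsSeparable (solenoidalOrGradient E) :=
    (isSeparable_univ_iff.2 (inferInstance : SeparableSpace (Lp E 2 (volume : Measure E)))).mono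
      (subset_univ _)
  exact hsep.exists_countable_dense_subset

end Fluid

/-! ### Pairings of a weak solution in `L^∞(0,T; L²)` with test fields -/

section Fluid

variable {E : Type*} [NormedAddCommGroup E] [InnerProductSpace ℝ E] [FiniteDimensional ℝ E]
  [MeasurableSpace E] [BorelSpace E]
variable {T ν : ℝ} {u₀ : E → E} {u : ℝ → E → E}

/-- **The space–time weak formulation tested with a product field, a.e.-slice version.** As the
accepted `IsWeakNSSolutionOn.test_smul`, but assuming `u(s) ∈ L²` only for a.e. `s ∈ (0, T)`:
for `Ψ ∈ C_c^∞(E; E)` divergence free and `η ∈ C_c^∞(ℝ)` with `supp η ⊆ (-∞, T)`,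
`∫_{(0,T)} (η' ⟨u,Ψ⟩ + η ∫(⟪u,(u·∇)Ψ⟫ + ν⟪u,ΔΨ⟫)) + η(0)⟨u₀,Ψ⟩ = 0`
(Serrin 1963, §3; Galdi 2000, proof of Lemma 2.1). [folklore] -/
theorem IsWeakNSSolutionOn.test_smul_ae (hu : IsWeakNSSolutionOn T ν 0 u₀ u)
    (hL2 : ∀ᵐ s ∂(volume.restrict (Ioo 0 T)), MemLp (u s) 2 volume)
    {Ψ : E → E} (hΨ : FunctionSpaces.IsTestFunctionOn (⊤ : Opens E) Ψ) (hΨdiv : VectorCalculus.IsDivFree Ψ)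
    {η : ℝ → ℝ} (hη : ContDiff ℝ ∞ η) (hηc : HasCompactSupport η) (hηT : tsupport η ⊆ Iio T) :
    (∫ s in Ioo 0 T, ((deriv η s * ∫ x, ⟪u s x, Ψ x⟫) +
        η s * ∫ x, (⟪u s x, convect (u s) Ψ x⟫ + ν * ⟪u s x, (Δ Ψ) x⟫))) +
      η 0 * ∫ x, ⟪u₀ x, Ψ x⟫ = 0 := by
  obtain ⟨-, -, -, hweak⟩ := hu
  have hΨd : Differentiable ℝ Ψ := hΨ.contDiff.differentiable (by simp)
  have hΨ2 : ContDiff ℝ 2 Ψ := contDiff_infty.1 hΨ.contDiff 2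
  have hηd : Differentiable ℝ η := hη.differentiable (by simp)
  have key := hweak (fun s x => η s • Ψ x) (isSpaceTimeTestOn_smul hη hηc hηT hΨ)
    (fun s => isDivFree_const_smul hΨdiv hΨd (η s))
  have hinit : ∫ x, ⟪u₀ x, η 0 • Ψ x⟫ = η 0 * ∫ x, ⟪u₀ x, Ψ x⟫ := by
    simp only [real_inner_smul_right]
    exact MeasureTheory.integral_const_mul _ _
  have hslice : ∀ᵐ s ∂(volume.restrict (Ioo 0 T)),
      ∫ x, (⟪u s x, timeDeriv (fun s x => η s • Ψ x) s x⟫ +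
        ⟪u s x, convect (u s) (fun x => η s • Ψ x) x⟫ +
        ν * ⟪u s x, (Δ fun x => η s • Ψ x) x⟫ + ⟪(0 : ℝ → E → E) s x, η s • Ψ x⟫) =
      (deriv η s * ∫ x, ⟪u s x, Ψ x⟫) +
        η s * ∫ x, (⟪u s x, convect (u s) Ψ x⟫ + ν * ⟪u s x, (Δ Ψ) x⟫) := by
    filter_upwards [hL2] with s hs
    have i1 : Integrable (fun x => ⟪u s x, Ψ x⟫) volume :=
      integrable_inner_of_memLp_two hs (hΨ.memLp_volume 2)
    have i2 : Integrable (fun x => ⟪u s x, convect (u s) Ψ x⟫ + ν * ⟪u s x, (Δ Ψ) x⟫) volume :=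
      (integrable_inner_fderiv_apply_of_memLp_two hs hs hΨ).add
        ((integrable_inner_of_memLp_two hs (hΨ.memLp_laplacian 2)).const_mul ν)
    have hpt : (fun x => ⟪u s x, timeDeriv (fun s x => η s • Ψ x) s x⟫ +
        ⟪u s x, convect (u s) (fun x => η s • Ψ x) x⟫ +
        ν * ⟪u s x, (Δ fun x => η s • Ψ x) x⟫ + ⟪(0 : ℝ → E → E) s x, η s • Ψ x⟫) =
        fun x => deriv η s * ⟪u s x, Ψ x⟫ +
          η s * (⟪u s x, convect (u s) Ψ x⟫ + ν * ⟪u s x, (Δ Ψ) x⟫) := by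
      ext x
      rw [timeDeriv_smul hηd, convect_const_smul (u s) hΨd, laplacian_const_smul hΨ2]
      simp only [real_inner_smul_right, Pi.zero_apply, inner_zero_left, add_zero]
      ring
    rw [hpt, integral_add (i1.const_mul _) (i2.const_mul _), MeasureTheory.integral_const_mul,
      MeasureTheory.integral_const_mul]
  rw [integral_congr_ae hslice, hinit] at key
  exact key

/-- The pairing `s ↦ ⟨u(s), Ψ⟩` of a weak solution with an a.e.-strongly measurable field is
a.e.-strongly measurable on `(0, T)` (joint measurability of `u` and Fubini). [folklore] -/
theorem IsWeakNSSolutionOn.aestronglyMeasurable_inner {f : ℝ → E → E}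
    (hu : IsWeakNSSolutionOn T ν f u₀ u)
    {Ψ : E → E} (hΨ : AEStronglyMeasurable Ψ (volume : Measure E)) :
    AEStronglyMeasurable (fun s => ∫ x, ⟪u s x, Ψ x⟫) (volume.restrict (Ioo 0 T)) := by
  have hu' : AEStronglyMeasurable (uncurry u)
      (((volume : Measure ℝ).restrict (Ioo 0 T)).prod (volume : Measure E)) := by
    rw [restrict_prod_volume_eq]; exact hu.1
  have h1 : AEStronglyMeasurable (fun p : ℝ × E => ⟪uncurry u p, Ψ p.2⟫)
      (((volume : Measure ℝ).restrict (Ioo 0 T)).prod (volume : Measure E)) :=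
    hu'.inner hΨ.comp_snd
  exact h1.integral_prod_right'

/-- The flux `s ↦ ∫ (⟪u, (u·∇)Ψ⟫ + ν⟪u, ΔΨ⟫)` of a weak solution against a test field is
a.e.-strongly measurable on `(0, T)`. [folklore] -/
theorem IsWeakNSSolutionOn.aestronglyMeasurable_flux {f : ℝ → E → E}
    (hu : IsWeakNSSolutionOn T ν f u₀ u)
    {Ψ : E → E} (hΨ : FunctionSpaces.IsTestFunctionOn (⊤ : Opens E) Ψ) :
    AEStronglyMeasurable (fun s => ∫ x, (⟪u s x, convect (u s) Ψ x⟫ + ν * ⟪u s x, (Δ Ψ) x⟫))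
      (volume.restrict (Ioo 0 T)) := by
  have hu' : AEStronglyMeasurable (uncurry u)
      (((volume : Measure ℝ).restrict (Ioo 0 T)).prod (volume : Measure E)) := by
    rw [restrict_prod_volume_eq]; exact hu.1
  have hA : Continuous fun p : ℝ × E => fderiv ℝ Ψ p.2 :=
    (hΨ.contDiff.continuous_fderiv (by simp)).comp continuous_snd
  have hAu : AEStronglyMeasurable (fun p : ℝ × E => fderiv ℝ Ψ p.2 (uncurry u p))
      (((volume : Measure ℝ).restrict (Ioo 0 T)).prod (volume : Measure E)) :=
    isBoundedBilinearMap_apply.continuous.comp_aestronglyMeasurable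
      (hA.aestronglyMeasurable.prodMk hu')
  have hL : AEStronglyMeasurable (fun p : ℝ × E => (Δ Ψ) p.2)
      (((volume : Measure ℝ).restrict (Ioo 0 T)).prod (volume : Measure E)) :=
    ((continuous_laplacian (contDiff_infty.1 hΨ.contDiff 2)).comp
      continuous_snd).aestronglyMeasurable
  have h1 : AEStronglyMeasurable
      (fun p : ℝ × E => ⟪uncurry u p, fderiv ℝ Ψ p.2 (uncurry u p)⟫ + ν * ⟪uncurry u p, (Δ Ψ) p.2⟫)
      (((volume : Measure ℝ).restrict (Ioo 0 T)).prod (volume : Measure E)) :=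
    (hu'.inner hAu).add ((hu'.inner hL).const_mul ν)
  exact h1.integral_prod_right'

/-- **`L^∞(0,T; L²)` in energy form.** If `u ∈ L^∞(0, T; L²)` (guarded mixed class) then
`u(s) ∈ L²` and `E(u(s)) ≤ ½ ‖u‖²_{L^∞(0,T;L²)}` for a.e. `s ∈ (0, T)`. [folklore] -/
theorem MemLqLp.ae_memLp_and_kineticEnergy_le (hE : MemLqLp ∞ 2 u (Ioo 0 T)) :
    ∀ᵐ s ∂(volume.restrict (Ioo 0 T)), MemLp (u s) 2 volume ∧
      eLpNorm (u s) 2 volume ≤ eLqLpNorm ∞ 2 u (Ioo 0 T) ∧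
      VectorCalculus.kineticEnergy (u s) ≤ 2⁻¹ * (eLqLpNorm ∞ 2 u (Ioo 0 T)).toReal ^ 2 := by
  have hN : eLqLpNorm ∞ 2 u (Ioo 0 T) ≠ ⊤ := hE.2.ne
  filter_upwards [hE.1, hE.ae_eLpNorm_le_top] with s hs hsN
  refine ⟨hs, hsN, ?_⟩
  have h2K : ENNReal.ofReal (2 * VectorCalculus.kineticEnergy (u s)) = eLpNorm (u s) 2 volume ^ 2 := by
    rw [← eEnergy_eq_ofReal _ hs, eEnergy_eq_eLpNorm_sq]
  have hle : ENNReal.ofReal (2 * VectorCalculus.kineticEnergy (u s)) ≤ eLqLpNorm ∞ 2 u (Ioo 0 T) ^ 2 := by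
    rw [h2K]; gcongr
  have hK0 : 0 ≤ 2 * VectorCalculus.kineticEnergy (u s) := mul_nonneg zero_le_two (kineticEnergy_nonneg _)
  have := (ENNReal.ofReal_le_iff_le_toReal (ENNReal.pow_ne_top hN)).1 hle
  rw [ENNReal.toReal_pow] at this
  linarith

/-- The pairing `s ↦ ⟨u(s), Ψ⟩` of a weak solution in `L^∞(0,T; L²)` with an `L²` field is
integrable on `(0, T)`. [folklore] -/
theorem IsWeakNSSolutionOn.integrableOn_inner_of_memLqLp {f : ℝ → E → E}
    (hu : IsWeakNSSolutionOn T ν f u₀ u) (hE : MemLqLp ∞ 2 u (Ioo 0 T))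
    {Ψ : E → E} (hΨ : MemLp Ψ 2 (volume : Measure E)) :
    IntegrableOn (fun s => ∫ x, ⟪u s x, Ψ x⟫) (Ioo 0 T) := by
  refine ⟨hu.aestronglyMeasurable_inner hΨ.1, ?_⟩
  refine HasFiniteIntegral.of_bounded
    (C := 2⁻¹ * (eLqLpNorm ∞ 2 u (Ioo 0 T)).toReal ^ 2 + VectorCalculus.kineticEnergy Ψ) ?_
  filter_upwards [hE.ae_memLp_and_kineticEnergy_le] with s hs
  rw [Real.norm_eq_abs]
  exact (abs_integral_inner_le_kineticEnergy_add hs.1 hΨ).trans (by linarith [hs.2.2])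

/-- The flux `s ↦ ∫ (⟪u, (u·∇)Ψ⟫ + ν⟪u, ΔΨ⟫)` of a weak solution in `L^∞(0,T; L²)` against a
test field is integrable on `(0, T)` (bounded a.e. by the energy). [folklore] -/
theorem IsWeakNSSolutionOn.integrableOn_flux_of_memLqLp {f : ℝ → E → E}
    (hu : IsWeakNSSolutionOn T ν f u₀ u) (hE : MemLqLp ∞ 2 u (Ioo 0 T))
    {Ψ : E → E} (hΨ : FunctionSpaces.IsTestFunctionOn (⊤ : Opens E) Ψ) :
    IntegrableOn (fun s => ∫ x, (⟪u s x, convect (u s) Ψ x⟫ + ν * ⟪u s x, (Δ Ψ) x⟫))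
      (Ioo 0 T) := by
  set C : ℝ := 2⁻¹ * (eLqLpNorm ∞ 2 u (Ioo 0 T)).toReal ^ 2 with hCdef
  obtain ⟨D, hD⟩ := hΨ.exists_norm_fderiv_le
  refine ⟨hu.aestronglyMeasurable_flux hΨ, ?_⟩
  refine HasFiniteIntegral.of_bounded
    (C := 2 * |D| * |C| + |ν| * (|C| + VectorCalculus.kineticEnergy (Δ Ψ))) ?_
  filter_upwards [hE.ae_memLp_and_kineticEnergy_le] with s hs
  obtain ⟨hmem, -, hsC⟩ := hs
  have i1 : Integrable (fun x => ⟪u s x, convect (u s) Ψ x⟫) volume :=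
    integrable_inner_fderiv_apply_of_memLp_two hmem hmem hΨ
  have i2 : Integrable (fun x => ⟪u s x, (Δ Ψ) x⟫) volume :=
    integrable_inner_of_memLp_two hmem (hΨ.memLp_laplacian 2)
  rw [Real.norm_eq_abs, integral_add i1 (i2.const_mul ν), MeasureTheory.integral_const_mul]
  have hK := kineticEnergy_nonneg (u s)
  have hKC : VectorCalculus.kineticEnergy (u s) ≤ |C| := hsC.trans (le_abs_self C)
  have b1 : |∫ x, ⟪u s x, convect (u s) Ψ x⟫| ≤ 2 * |D| * |C| := by
    have := abs_integral_inner_fderiv_apply_le hmem (fun x => (hD x).trans (le_abs_self D))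
    simp only [convect_apply] at this ⊢
    calc _ ≤ 2 * |D| * VectorCalculus.kineticEnergy (u s) := this
      _ ≤ 2 * |D| * |C| := by gcongr
  have b2 : |ν * ∫ x, ⟪u s x, (Δ Ψ) x⟫| ≤ |ν| * (|C| + VectorCalculus.kineticEnergy (Δ Ψ)) := by
    rw [abs_mul]
    gcongr
    exact (abs_integral_inner_le_kineticEnergy_add hmem (hΨ.memLp_laplacian 2)).trans
      (by linarith)
  exact (abs_add_le _ _).trans (add_le_add b1 b2)

/-- **The time-sliced weak formulation, a.e. form.** Let `u` be a weak solution of the unforced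
Navier–Stokes system on `E × [0, T)` with datum `u₀`, lying in `L^∞(0, T; L²)`, and let
`Ψ ∈ C_c^∞(E; E)` be divergence free. Then for a.e. `t ∈ (0, T)`
`⟨u(t), Ψ⟩ = ⟨u₀, Ψ⟩ + ∫_{(0,t]} ∫ (⟪u, (u·∇)Ψ⟫ + ν ⟪u, ΔΨ⟫) dx ds`
(Galdi 2000, Lemma 2.1; Serrin 1963, §3, (6); the du Bois-Reymond lemma with initial datum in
its a.e. form, accepted `Literature.Analysis.FunctionSpaces.ae_eq_add_setIntegral_of_forall_test`). [cite: Galdi2000, Lemma 2.1] -/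
theorem IsWeakNSSolutionOn.ae_inner_test_eq (hu : IsWeakNSSolutionOn T ν 0 u₀ u)
    (hE : MemLqLp ∞ 2 u (Ioo 0 T))
    {Ψ : E → E} (hΨ : FunctionSpaces.IsTestFunctionOn (⊤ : Opens E) Ψ) (hΨdiv : VectorCalculus.IsDivFree Ψ) :
    ∀ᵐ t ∂(volume.restrict (Ioo 0 T)), ∫ x, ⟪u t x, Ψ x⟫ = (∫ x, ⟪u₀ x, Ψ x⟫) +
      ∫ s in Ioc 0 t, ∫ x, (⟪u s x, convect (u s) Ψ x⟫ + ν * ⟪u s x, (Δ Ψ) x⟫) :=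
  FunctionSpaces.ae_eq_add_setIntegral_of_forall_test (hu.integrableOn_inner_of_memLqLp hE (hΨ.memLp_volume 2))
    (hu.integrableOn_flux_of_memLqLp hE hΨ) fun _ hη hηc hηT =>
      hu.test_smul_ae (hE.ae_memLp_and_kineticEnergy_le.mono fun _ hs => hs.1) hΨ hΨdiv hη hηc hηT

end Fluid

/-! ### Hilbert-space glue: vectors and continuity determined by a dense set of pairings -/

section HilbertGlue

variable {H : Type*} [NormedAddCommGroup H] [InnerProductSpace ℝ H] [CompleteSpace H]

omit [CompleteSpace H] in
/-- Two vectors with the same pairings against a set with dense span are equal. [folklore] -/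
theorem eq_of_forall_inner_eq_of_dense_span {D : Set H}
    (hD : Dense ((Submodule.span ℝ D : Submodule ℝ H) : Set H)) {a b : H}
    (h : ∀ d ∈ D, ⟪a, d⟫ = ⟪b, d⟫) : a = b := by
  let K : Submodule ℝ H := LinearMap.ker ((innerSL ℝ (a - b) : H →L[ℝ] ℝ) : H →ₗ[ℝ] ℝ)
  have hK : IsClosed (K : Set H) := ContinuousLinearMap.isClosed_ker _
  have hDK : D ⊆ K := fun d hd => by
    show innerSL ℝ (a - b) d = 0
    rw [innerSL_apply_apply, inner_sub_left, h d hd, sub_self]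
  have hspan : (Submodule.span ℝ D : Submodule ℝ H) ≤ K := Submodule.span_le.2 hDK
  have hKuniv : (K : Set H) = univ := by
    rw [← hK.closure_eq, (hD.mono hspan).closure_eq]
  have hab : a - b ∈ K := by
    have : a - b ∈ (K : Set H) := by rw [hKuniv]; exact mem_univ _
    exact this
  have h0 : ⟪a - b, a - b⟫ = 0 := by
    have : innerSL ℝ (a - b) (a - b) = 0 := hab
    rwa [innerSL_apply_apply] at this
  rwa [inner_self_eq_zero, sub_eq_zero] at h0

omit [CompleteSpace H] in
/-- **Weak continuity from a dense set of pairings.** If `Y : ℝ → H` is bounded on `s` and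
`t ↦ ⟪Y t, d⟫` is continuous on `s` for every `d` in a set with dense span, then `t ↦ ⟪Y t, w⟫`
is continuous on `s` for every `w ∈ H` (uniform approximation). [folklore] -/
theorem continuousOn_inner_of_dense_span {s : Set ℝ} {Y : ℝ → H} {M : ℝ}
    (hM : ∀ t ∈ s, ‖Y t‖ ≤ M) {D : Set H}
    (hD : Dense ((Submodule.span ℝ D : Submodule ℝ H) : Set H))
    (hc : ∀ d ∈ D, ContinuousOn (fun t => ⟪Y t, d⟫) s) (w : H) :
    ContinuousOn (fun t => ⟪Y t, w⟫) s := by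
  let W : Submodule ℝ H :=
    { carrier := {w | ContinuousOn (fun t => ⟪Y t, w⟫) s}
      add_mem' := by
        intro v w hv hw
        have : ContinuousOn (fun t => ⟪Y t, v⟫ + ⟪Y t, w⟫) s := hv.add hw
        show ContinuousOn (fun t => ⟪Y t, v + w⟫) s
        simpa only [inner_add_right] using this
      zero_mem' := by
        show ContinuousOn (fun t => ⟪Y t, (0 : H)⟫) s
        simpa using continuousOn_const
      smul_mem' := by
        intro c v hv
        have : ContinuousOn (fun t => c * ⟪Y t, v⟫) s := continuousOn_const.mul hv
        show ContinuousOn (fun t => ⟪Y t, c • v⟫) s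
        simpa only [real_inner_smul_right] using this }
  have hDW : D ⊆ W := fun d hd => hc d hd
  have hspan : (Submodule.span ℝ D : Submodule ℝ H) ≤ W := Submodule.span_le.2 hDW
  have hclosed : IsClosed (W : Set H) := by
    refine isClosed_of_closure_subset fun w hw => ?_
    obtain ⟨wn, hwnW, hwn⟩ := mem_closure_iff_seq_limit.1 hw
    have hunif : TendstoUniformlyOn (fun n t => ⟪Y t, wn n⟫) (fun t => ⟪Y t, w⟫) atTop s := by
      refine Metric.tendstoUniformlyOn_iff.2 fun ε hε => ?_
      have hδ : 0 < ε / (|M| + 1) := by positivity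
      filter_upwards [(tendsto_order.1 (tendsto_iff_norm_sub_tendsto_zero.1 hwn)).2 _ hδ]
        with n hn t ht
      rw [Real.dist_eq, ← inner_sub_right]
      calc |⟪Y t, w - wn n⟫| ≤ ‖Y t‖ * ‖w - wn n‖ := abs_real_inner_le_norm _ _
        _ ≤ |M| * (ε / (|M| + 1)) := by
            gcongr
            · exact (hM t ht).trans (le_abs_self M)
            · rw [← norm_neg, neg_sub]; exact hn.le
        _ < ε := by
            rw [mul_div_assoc', div_lt_iff₀ (by positivity)]
            nlinarith [abs_nonneg M]
    exact hunif.continuousOn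
      (Eventually.of_forall fun n => (hwnW n : ContinuousOn (fun t => ⟪Y t, wn n⟫) s)).frequently
  have hWuniv : (W : Set H) = univ := by
    rw [← hclosed.closure_eq, (hD.mono hspan).closure_eq]
  have : w ∈ (W : Set H) := by rw [hWuniv]; exact mem_univ w
  exact this

end HilbertGlue

section Fluid

variable {E : Type*} [NormedAddCommGroup E] [InnerProductSpace ℝ E] [FiniteDimensional ℝ E]
  [MeasurableSpace E] [BorelSpace E]

/-- The `L²` pairing of two classes built from `L²` functions is the integral of the pointwise
pairing. [folklore] -/
theorem inner_toLp_toLp_eq_integral {f g : E → E} (hf : MemLp f 2 (volume : Measure E))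
    (hg : MemLp g 2 (volume : Measure E)) :
    ⟪hf.toLp f, hg.toLp g⟫ = ∫ x, ⟪f x, g x⟫ := by
  rw [L2.inner_def]
  refine integral_congr_ae ?_
  filter_upwards [hf.coeFn_toLp, hg.coeFn_toLp] with x hx hy
  rw [hx, hy]

/-- The `L²` pairing of the class of an `L²` function with a class `d` is `∫ ⟪f, d⟫`. [folklore] -/
theorem inner_toLp_eq_integral {f : E → E} (hf : MemLp f 2 (volume : Measure E))
    (d : Lp E 2 (volume : Measure E)) :
    ⟪hf.toLp f, d⟫ = ∫ x, ⟪f x, d x⟫ := by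
  rw [L2.inner_def]
  refine integral_congr_ae ?_
  filter_upwards [hf.coeFn_toLp] with x hx
  rw [hx]

/-- A conull subset of `(0, T)` on which an a.e. property holds everywhere, chosen measurable. [folklore] -/
theorem exists_measurable_good_set {T : ℝ} {P : ℝ → Prop}
    (h : ∀ᵐ t ∂(volume.restrict (Ioo 0 T)), P t) :
    ∃ S ⊆ Ioo 0 T, MeasurableSet S ∧ (∀ t ∈ S, P t) ∧
      (∀ᵐ t ∂(volume.restrict (Ioo 0 T)), t ∈ S) ∧ volume (Ioo 0 T \ S) = 0 := by
  obtain ⟨N, hNsub, hNmeas, hNnull⟩ := exists_measurable_superset_of_null (ae_iff.1 h)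
  refine ⟨Ioo 0 T \ N, sdiff_subset, measurableSet_Ioo.diff hNmeas, fun t ht => ?_, ?_, ?_⟩
  · by_contra hP
    exact ht.2 (hNsub hP)
  · have hN' : ∀ᵐ t ∂(volume.restrict (Ioo 0 T)), t ∉ N := by
      rw [ae_iff]; simpa using hNnull
    filter_upwards [hN', ae_restrict_mem measurableSet_Ioo] with t ht ht'
    exact ⟨ht', ht⟩
  · rw [sdiff_sdiff_right_self, inter_comm]
    rwa [Measure.restrict_apply hNmeas] at hNnull

/-- A conull subset of `(0, T)`, `T > 0`, is dense in `[0, T]`. [folklore] -/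
theorem Icc_subset_closure_of_conull {T : ℝ} (hT : 0 < T) {S : Set ℝ}
    (hnull : volume (Ioo 0 T \ S) = 0) : Icc 0 T ⊆ closure S := by
  have hIoo : Ioo 0 T ⊆ closure S := by
    intro t ht
    by_contra hcl
    obtain ⟨ε, hε, hball⟩ : ∃ ε > 0, Metric.ball t ε ∩ S = ∅ := by
      have := Metric.mem_closure_iff.not.1 hcl
      push Not at this
      obtain ⟨ε, hε, hfar⟩ := this
      refine ⟨ε, hε, eq_empty_of_forall_notMem fun s hs => ?_⟩
      exact (not_lt.2 (hfar s hs.2)) (by rw [dist_comm]; exact Metric.mem_ball.1 hs.1)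
    have hsub : Metric.ball t ε ∩ Ioo 0 T ⊆ Ioo 0 T \ S := fun s hs =>
      ⟨hs.2, fun hsS => by
        have : s ∈ Metric.ball t ε ∩ S := ⟨hs.1, hsS⟩
        rw [hball] at this; exact this⟩
    have hpos : 0 < volume (Metric.ball t ε ∩ Ioo 0 T) :=
      (Metric.isOpen_ball.inter isOpen_Ioo).measure_pos volume ⟨t, Metric.mem_ball_self hε, ht⟩
    exact absurd (measure_mono_null hsub hnull) hpos.ne'
  calc Icc 0 T = closure (Ioo 0 T) := (closure_Ioo hT.ne).symm
    _ ⊆ closure S := closure_minimal hIoo isClosed_closure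

/-- Changing the time slices of a field on a null set of times in `(0, T)` does not change it
a.e. on the strip `(0, T) × E`. [folklore] -/
theorem uncurry_ae_eq_of_ae_slice_eq {T : ℝ} {u v : ℝ → E → E}
    (h : ∀ᵐ t ∂(volume.restrict (Ioo 0 T)), v t = u t) :
    uncurry v =ᵐ[volume.restrict (Ioo 0 T ×ˢ (univ : Set E))] uncurry u := by
  obtain ⟨S, hSsub, hSmeas, hSP, -, hSnull⟩ := exists_measurable_good_set h
  have hbad : {p : ℝ × E | uncurry v p ≠ uncurry u p} ⊆ (Ioo 0 T \ S) ×ˢ univ ∪ (Ioo 0 T ×ˢ univ)ᶜ := by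
    intro p hp
    by_cases hpT : p ∈ Ioo 0 T ×ˢ (univ : Set E)
    · left
      refine ⟨⟨hpT.1, fun hS => hp ?_⟩, mem_univ _⟩
      simp only [uncurry, hSP p.1 hS]
    · right; exact hpT
  rw [Filter.EventuallyEq, ae_iff]
  refine measure_mono_null hbad ?_
  rw [Measure.restrict_apply' (measurableSet_Ioo.prod MeasurableSet.univ)]
  have : ((Ioo 0 T \ S) ×ˢ univ ∪ (Ioo 0 T ×ˢ univ)ᶜ) ∩ Ioo 0 T ×ˢ (univ : Set E) =
      (Ioo 0 T \ S) ×ˢ univ := by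
    rw [union_inter_distrib_right, compl_inter_self, union_empty,
      inter_eq_left.2 (prod_mono sdiff_subset Subset.rfl)]
  rw [this, Measure.volume_eq_prod, Measure.prod_prod, hSnull, zero_mul]

/-- Changing the time slices of a weak solution on a null set of times in `(0, T)` gives a weak
solution (same datum, force `0`): every clause of `IsWeakNSSolutionOn` sees `u` only through
integrals over `(0, T)` or a.e. in time. [folklore] -/
theorem IsWeakNSSolutionOn.congr_ae_slice {T ν : ℝ} {u₀ : E → E} {u v : ℝ → E → E}
    (hu : IsWeakNSSolutionOn T ν 0 u₀ u) (h : ∀ᵐ t ∂(volume.restrict (Ioo 0 T)), v t = u t) :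
    IsWeakNSSolutionOn T ν 0 u₀ v := by
  obtain ⟨hm, hloc, hdiv, hweak⟩ := hu
  have hae := uncurry_ae_eq_of_ae_slice_eq h
  refine ⟨hm.congr hae.symm, fun K hK => ?_, ?_, fun ψ hψ hψdiv => ?_⟩
  · have hae' : uncurry v =ᵐ[volume.restrict (Ioo 0 T ×ˢ K)] uncurry u :=
      ae_mono (Measure.restrict_mono (prod_mono Subset.rfl (subset_univ K)) le_rfl) hae
    rw [lintegral_congr_ae (hae'.mono fun p hp => by rw [hp])]
    exact hloc K hK
  · filter_upwards [hdiv, h] with t ht hvt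
    rw [hvt]; exact ht
  · convert hweak ψ hψ hψdiv using 2
    refine integral_congr_ae ?_
    filter_upwards [h] with t ht
    simp only [ht]

/-! ### The weakly continuous representative -/

section Representative

variable {T ν : ℝ} {u₀ : E → E} {u : ℝ → E → E}

/-- **Continuous models of the pairings with the generators.** For a weak solution in
`L^∞(0, T; L²)` with datum `u₀ ∈ L²_σ` and a generator `d` (class of a divergence-free test field
`φ`, or of a test gradient `∇q`) there is a function `g`, continuous on `[0, T]`, with
`g(0) = ⟨u₀, d⟩` and `⟨u(t), d⟩ = g(t)` for a.e. `t ∈ (0, T)`: `g = ⟨u₀, φ⟩ + ∫_{(0,·]} (flux)` in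
the first case (a.e. slice identity), `g = 0` in the second (the slices and the datum are weakly
divergence free). [folklore] -/
theorem IsWeakNSSolutionOn.exists_continuousOn_model (hu : IsWeakNSSolutionOn T ν 0 u₀ u)
    (hE : MemLqLp ∞ 2 u (Ioo 0 T)) (hdiv₀ : IsWeaklyDivFree u₀)
    {d : Lp E 2 (volume : Measure E)} (hd : d ∈ solenoidalOrGradient E) :
    ∃ g : ℝ → ℝ, ContinuousOn g (Icc 0 T) ∧ g 0 = ∫ x, ⟪u₀ x, d x⟫ ∧
      ∀ᵐ t ∂(volume.restrict (Ioo 0 T)), ∫ x, ⟪u t x, d x⟫ = g t := by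
  rcases hd with ⟨φ, hφ, hφdiv, hdφ⟩ | ⟨q, hq, hdq⟩
  · set F : ℝ → ℝ := fun s => ∫ x, (⟪u s x, convect (u s) φ x⟫ + ν * ⟪u s x, (Δ φ) x⟫) with hF
    have hFint : IntegrableOn F (Ioo 0 T) := hu.integrableOn_flux_of_memLqLp hE hφ
    have hFint' : IntegrableOn F (Icc 0 T) :=
      (integrableOn_Icc_iff_integrableOn_Ioo (by simp) (by simp)).2 hFint
    refine ⟨fun t => (∫ x, ⟪u₀ x, φ x⟫) + ∫ s in Ioc 0 t, F s, ?_, ?_, ?_⟩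
    · exact continuousOn_const.add (intervalIntegral.continuousOn_primitive hFint')
    · simp only [Ioc_self, Measure.restrict_empty, integral_zero_measure, add_zero]
      exact integral_congr_ae (hdφ.mono fun x hx => by simp only [hx])
    · filter_upwards [hu.ae_inner_test_eq hE hφ hφdiv] with t ht
      rw [← ht]
      exact integral_congr_ae (hdφ.mono fun x hx => by simp only [hx])
  · refine ⟨fun _ => 0, continuousOn_const, ?_, ?_⟩
    · rw [integral_congr_ae (hdq.mono fun x hx => show ⟪u₀ x, d x⟫ = ⟪u₀ x, gradient q x⟫ by rw [hx])]
      exact (hdiv₀ q hq).symm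
    · filter_upwards [hu.2.2.1] with t ht
      rw [integral_congr_ae (hdq.mono fun x hx => show ⟪u t x, d x⟫ = ⟪u t x, gradient q x⟫ by rw [hx])]
      exact ht q hq

/-- **Weak solutions in `L^∞(0,T; L²)` are weakly `L²`-continuous after a redefinition on a null
set of times** (Sohr 2001, Ch. V, Thm. 1.3.1, weak-continuity assertion; Galdi 2000, Lemma 2.2;
Temam 1977, Ch. III, (3.36)/Lemma 1.4 for the abstract principle). Let `u` be a weak solution of
the unforced Navier–Stokes system on `E × [0, T)`, `T > 0`, with datum `u₀ ∈ L²_σ` (square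
integrable, weakly divergence free), and let `u ∈ L^∞(0, T; L²)` (guarded mixed class). Then
there is `v : ℝ → E → E` with the **same slices as `u` at a.e. time** `t ∈ (0, T)`, `v(0) = u₀`,
every slice `v(t)`, `t ∈ [0, T]`, in `L²` with `‖v(t)‖₂ ≤ ‖u‖_{L^∞(0,T;L²)}` and weakly
divergence free (so `v(t) ∈ L²_σ` at **every** `t`, as printed: Sohr, p. 214), again a weak
solution with datum `u₀`, and **weakly continuous into `L²` on `[0, T]`**: `t ↦ ∫ ⟪v(t), w⟫` is
continuous on `[0, T]` for every `w ∈ L²(E; E)`.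
Proof: the pairings `t ↦ ⟨u(t), d⟩` with a countable family of generators `d` with dense span
(divergence-free test fields and test gradients, `dense_span_solenoidalOrGradient`) agree a.e.
with continuous functions (`exists_continuousOn_model`); on the conull good set `S` the slices are
bounded in `L²`, so at every `t₀ ∈ [0, T] ⊆ closure S` the weak limit of `u(t)`, `t → t₀` in `S`,
exists (`exists_forall_tendsto_inner_of_dense_span`), equals `u(t₀)` on `S` and `u₀` at `0`, is
bounded by `‖u‖_{L^∞ L²}` and depends weakly continuously on `t₀`
(`continuousOn_inner_of_dense_span`); `v` is `u` on `S`, `u₀` at `0`, and a representative of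
the weak limit elsewhere. Note `‖u₀‖₂ ≤ ‖u‖_{L^∞(0,T;L²)}` is part of the conclusion (`t = 0`). [cite: Sohr2001, Ch. V Thm. 1.3.1 (weak continuity after redefinition)] -/
theorem IsWeakNSSolutionOn.exists_weaklyContinuousOn_version (hu : IsWeakNSSolutionOn T ν 0 u₀ u)
    (hT : 0 < T) (hE : MemLqLp ∞ 2 u (Ioo 0 T)) (hu₀ : MemLp u₀ 2 volume)
    (hdiv₀ : IsWeaklyDivFree u₀) :
    ∃ v : ℝ → E → E,
      (∀ᵐ t ∂(volume.restrict (Ioo 0 T)), v t = u t) ∧ v 0 = u₀ ∧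
      (∀ t ∈ Icc 0 T, MemLp (v t) 2 volume ∧ eLpNorm (v t) 2 volume ≤ eLqLpNorm ∞ 2 u (Ioo 0 T)) ∧
      IsWeakNSSolutionOn T ν 0 u₀ v ∧ (∀ t ∈ Icc 0 T, IsWeaklyDivFree (v t)) ∧
      ∀ w : E → E, MemLp w 2 volume → ContinuousOn (fun t => ∫ x, ⟪v t x, w x⟫) (Icc 0 T) := by
  classical
  set N : ℝ≥0∞ := eLqLpNorm ∞ 2 u (Ioo 0 T) with hNdef
  have hN : N ≠ ⊤ := hE.2.ne
  set M : ℝ := N.toReal with hMdef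
  -- countable generators with dense span
  obtain ⟨D₀, hD₀sub, hD₀c, hD₀cl⟩ := exists_countable_dense_solenoidalOrGradient (E := E)
  have hD₀dense : Dense ((Submodule.span ℝ D₀ :
      Submodule ℝ (Lp E 2 (volume : Measure E))) : Set (Lp E 2 (volume : Measure E))) := by
    have h1 : solenoidalOrGradient E ⊆ ((Submodule.span ℝ D₀ :
        Submodule ℝ (Lp E 2 (volume : Measure E))).topologicalClosure : Set _) :=
      hD₀cl.trans (by
        rw [Submodule.topologicalClosure_coe]
        exact closure_mono Submodule.subset_span)
    have h2 : (Submodule.span ℝ (solenoidalOrGradient E) : Submodule ℝ (Lp E 2 volume)) ≤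
        (Submodule.span ℝ D₀).topologicalClosure := Submodule.span_le.2 h1
    have h3 : Dense (((Submodule.span ℝ D₀ : Submodule ℝ (Lp E 2 (volume : Measure E)))
        ).topologicalClosure : Set (Lp E 2 (volume : Measure E))) :=
      dense_span_solenoidalOrGradient.mono h2
    rwa [Submodule.topologicalClosure_coe, dense_closure] at h3
  -- continuous models of the pairings with the generators
  have hmodel : ∀ d ∈ D₀, ∃ g : ℝ → ℝ, ContinuousOn g (Icc 0 T) ∧ g 0 = ∫ x, ⟪u₀ x, d x⟫ ∧
      ∀ᵐ t ∂(volume.restrict (Ioo 0 T)), ∫ x, ⟪u t x, d x⟫ = g t := fun d hd =>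
    hu.exists_continuousOn_model hE hdiv₀ (hD₀sub hd)
  choose! g hg_cont hg0 hg_ae using hmodel
  -- the good set of times
  have hall : ∀ᵐ t ∂(volume.restrict (Ioo 0 T)),
      (MemLp (u t) 2 volume ∧ eLpNorm (u t) 2 volume ≤ N) ∧ ∀ d ∈ D₀, ∫ x, ⟪u t x, d x⟫ = g d t := by
    refine (hE.ae_memLp_and_kineticEnergy_le.mono fun t ht => ⟨ht.1, ht.2.1⟩).and ?_
    exact (eventually_countable_ball hD₀c).2 fun d hd => hg_ae d hd
  obtain ⟨S, hSsub, -, hSP, hSae, hSnull⟩ := exists_measurable_good_set hall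
  have hScl : Icc 0 T ⊆ closure S := Icc_subset_closure_of_conull hT hSnull
  have hSIcc : S ⊆ Icc 0 T := hSsub.trans Ioo_subset_Icc_self
  -- `L²` classes of the good slices
  let x : ℝ → Lp E 2 (volume : Measure E) := fun t =>
    if h : MemLp (u t) 2 volume then h.toLp (u t) else 0
  have hxS : ∀ t (ht : t ∈ S), x t = (hSP t ht).1.1.toLp (u t) := fun t ht => dif_pos (hSP t ht).1.1
  have hxnorm : ∀ t ∈ S, ‖x t‖ ≤ M := fun t ht => by
    rw [hxS t ht, Lp.norm_toLp]
    exact ENNReal.toReal_mono hN (hSP t ht).1.2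
  have hxinner : ∀ t ∈ S, ∀ d ∈ D₀, ⟪x t, d⟫ = g d t := fun t ht d hd => by
    rw [hxS t ht, inner_toLp_eq_integral]
    exact (hSP t ht).2 d hd
  have hgS : ∀ d ∈ D₀, ∀ t₀ ∈ Icc 0 T, Tendsto (fun t => ⟪x t, d⟫) (𝓝[S] t₀) (𝓝 (g d t₀)) := by
    intro d hd t₀ ht₀
    have hgt : Tendsto (g d) (𝓝[S] t₀) (𝓝 (g d t₀)) :=
      ((hg_cont d hd) t₀ ht₀).mono_left (nhdsWithin_mono _ hSIcc)
    exact hgt.congr' (eventually_mem_nhdsWithin.mono fun t ht => (hxinner t ht d hd).symm)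
  -- weak limits at every `t₀ ∈ [0, T]`
  have hlim : ∀ t₀ ∈ Icc 0 T, ∃ y : Lp E 2 (volume : Measure E), ‖y‖ ≤ M ∧
      ∀ w, Tendsto (fun t => ⟪x t, w⟫) (𝓝[S] t₀) (𝓝 ⟪y, w⟫) := by
    intro t₀ ht₀
    haveI : (𝓝[S] t₀).NeBot := mem_closure_iff_nhdsWithin_neBot.1 (hScl ht₀)
    exact exists_forall_tendsto_inner_of_dense_span (eventually_mem_nhdsWithin.mono hxnorm)
      hD₀dense fun d hd => ⟨g d t₀, hgS d hd t₀ ht₀⟩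
  choose! Y hYnorm hYlim using hlim
  -- identification on `S`, at `0`, and with the models
  have hYg : ∀ d ∈ D₀, ∀ t ∈ Icc 0 T, ⟪Y t, d⟫ = g d t := fun d hd t ht => by
    haveI : (𝓝[S] t).NeBot := mem_closure_iff_nhdsWithin_neBot.1 (hScl ht)
    exact tendsto_nhds_unique (hYlim t ht d) (hgS d hd t ht)
  have hYS : ∀ t ∈ S, Y t = x t := fun t ht => by
    refine (ext_inner_right ℝ fun w => ?_).symm
    have h1 := (hYlim t (hSIcc ht) w).mono_left (pure_le_nhdsWithin ht)
    exact tendsto_nhds_unique (tendsto_pure_nhds _ t) h1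
  have hY0 : Y 0 = hu₀.toLp u₀ := by
    refine eq_of_forall_inner_eq_of_dense_span hD₀dense fun d hd => ?_
    rw [hYg d hd 0 (left_mem_Icc.2 hT.le), hg0 d hd, inner_toLp_eq_integral]
  -- weak continuity of `Y`
  have hYcont : ∀ w : Lp E 2 (volume : Measure E), ContinuousOn (fun t => ⟪Y t, w⟫) (Icc 0 T) :=
    continuousOn_inner_of_dense_span hYnorm hD₀dense fun d hd =>
      (hg_cont d hd).congr fun t ht => hYg d hd t ht
  -- the representative
  have h0S : (0 : ℝ) ∉ S := fun h => lt_irrefl _ (hSsub h).1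
  let v : ℝ → E → E := fun t => if t ∈ S then u t else if t = 0 then u₀ else (Y t : E → E)
  have hvS : ∀ t ∈ S, v t = u t := fun t ht => if_pos ht
  have hv0 : v 0 = u₀ := by
    show (if (0 : ℝ) ∈ S then u 0 else if (0 : ℝ) = 0 then u₀ else (Y 0 : E → E)) = u₀
    rw [if_neg h0S, if_pos rfl]
  have hvY : ∀ t ∈ Icc 0 T, ∃ h : MemLp (v t) 2 volume, h.toLp (v t) = Y t := by
    intro t ht
    by_cases hS : t ∈ S
    · have hmem : MemLp (v t) 2 volume := by rw [hvS t hS]; exact (hSP t hS).1.1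
      refine ⟨hmem, ?_⟩
      rw [hYS t hS, hxS t hS]
      exact MemLp.toLp_congr hmem (hSP t hS).1.1 (by rw [hvS t hS])
    · by_cases h0 : t = 0
      · subst h0
        have hmem : MemLp (v 0) 2 volume := by rw [hv0]; exact hu₀
        refine ⟨hmem, ?_⟩
        rw [hY0]
        exact MemLp.toLp_congr hmem hu₀ (by rw [hv0])
      · have hvt : v t = (Y t : E → E) := by
          show (if t ∈ S then u t else if t = 0 then u₀ else (Y t : E → E)) = _
          rw [if_neg hS, if_neg h0]
        have hmem : MemLp (v t) 2 volume := by rw [hvt]; exact Lp.memLp (Y t)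
        refine ⟨hmem, ?_⟩
        rw [MemLp.toLp_congr hmem (Lp.memLp (Y t)) (by rw [hvt])]
        exact Lp.toLp_coeFn _ _
  have hae : ∀ᵐ t ∂(volume.restrict (Ioo 0 T)), v t = u t := hSae.mono hvS
  have hvw : IsWeakNSSolutionOn T ν 0 u₀ v := hu.congr_ae_slice hae
  have hvcont : ∀ w : E → E, MemLp w 2 volume →
      ContinuousOn (fun t => ∫ x, ⟪v t x, w x⟫) (Icc 0 T) := fun w hw => by
    refine (hYcont (hw.toLp w)).congr fun t ht => ?_
    obtain ⟨hmem, hcl⟩ := hvY t ht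
    show ∫ x, ⟪v t x, w x⟫ = ⟪Y t, hw.toLp w⟫
    rw [← hcl, inner_toLp_toLp_eq_integral]
  -- every slice is weakly divergence free: the pairing with a test gradient is continuous on
  -- `[0, T]` and vanishes at a.e. time, hence on a dense subset
  have hvdiv : ∀ t ∈ Icc 0 T, IsWeaklyDivFree (v t) := fun t ht q hq => by
    obtain ⟨S', hS'sub, -, hS'P, -, hS'null⟩ := exists_measurable_good_set hvw.2.2.1
    haveI : (𝓝[S'] t).NeBot :=
      mem_closure_iff_nhdsWithin_neBot.1 (Icc_subset_closure_of_conull hT hS'null ht)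
    have h1 : Tendsto (fun s => ∫ x, ⟪v s x, gradient q x⟫) (𝓝[S'] t)
        (𝓝 (∫ x, ⟪v t x, gradient q x⟫)) :=
      ((hvcont _ (hq.memLp_gradient 2)) t ht).mono_left
        (nhdsWithin_mono _ (hS'sub.trans Ioo_subset_Icc_self))
    have h2 : Tendsto (fun s => ∫ x, ⟪v s x, gradient q x⟫) (𝓝[S'] t) (𝓝 0) :=
      tendsto_const_nhds.congr' (eventually_mem_nhdsWithin.mono fun s hs => ((hS'P s hs) q hq).symm)
    exact tendsto_nhds_unique h1 h2
  refine ⟨v, hae, hv0, fun t ht => ?_, hvw, hvdiv, hvcont⟩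
  obtain ⟨hmem, hcl⟩ := hvY t ht
  refine ⟨hmem, ?_⟩
  have h1 : (eLpNorm (v t) 2 volume).toReal ≤ M := by
    rw [← Lp.norm_toLp (v t) hmem, hcl]; exact hYnorm t ht
  exact (ENNReal.toReal_le_toReal hmem.eLpNorm_ne_top hN).1 h1

/-- **The time-sliced weak formulation at every time, for weakly continuous solutions.** Let `u`
be a weak solution of the unforced system on `E × [0, T)`, `T > 0`, in `L^∞(0, T; L²)`, and let
`Ψ ∈ C_c^∞(E; E)` be divergence free. If the pairing `t ↦ ⟨u(t), Ψ⟩` is continuous on `[0, T]`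
(e.g. for the representative of `exists_weaklyContinuousOn_version`), then for **every**
`t ∈ [0, T]`: `⟨u(t), Ψ⟩ = ⟨u₀, Ψ⟩ + ∫_{(0,t]} ∫ (⟪u, (u·∇)Ψ⟫ + ν ⟪u, ΔΨ⟫) dx ds`
(Galdi 2000, Lemma 2.1; Serrin 1963, §3, (6)): on `(0, T)` by the du Bois-Reymond lemma with
initial datum (accepted `Literature.Analysis.FunctionSpaces.eq_add_setIntegral_of_forall_test`), at the endpoints by continuity
of both sides. [cite: Galdi2000, Lemma 2.1] -/
theorem IsWeakNSSolutionOn.inner_test_eq_of_continuousOn (hu : IsWeakNSSolutionOn T ν 0 u₀ u)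
    (hT : 0 < T) (hE : MemLqLp ∞ 2 u (Ioo 0 T))
    {Ψ : E → E} (hΨ : FunctionSpaces.IsTestFunctionOn (⊤ : Opens E) Ψ) (hΨdiv : VectorCalculus.IsDivFree Ψ)
    (hcont : ContinuousOn (fun t => ∫ x, ⟪u t x, Ψ x⟫) (Icc 0 T)) {t : ℝ} (ht : t ∈ Icc 0 T) :
    ∫ x, ⟪u t x, Ψ x⟫ = (∫ x, ⟪u₀ x, Ψ x⟫) +
      ∫ s in Ioc 0 t, ∫ x, (⟪u s x, convect (u s) Ψ x⟫ + ν * ⟪u s x, (Δ Ψ) x⟫) := by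
  set F : ℝ → ℝ := fun s => ∫ x, (⟪u s x, convect (u s) Ψ x⟫ + ν * ⟪u s x, (Δ Ψ) x⟫) with hF
  have hUint := hu.integrableOn_inner_of_memLqLp hE (hΨ.memLp_volume 2)
  have hFint : IntegrableOn F (Ioo 0 T) := hu.integrableOn_flux_of_memLqLp hE hΨ
  have hFint' : IntegrableOn F (Icc 0 T) :=
    (integrableOn_Icc_iff_integrableOn_Ioo (by simp) (by simp)).2 hFint
  have hid : ∀ η : ℝ → ℝ, ContDiff ℝ ∞ η → HasCompactSupport η → tsupport η ⊆ Iio T →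
      (∫ s in Ioo 0 T, (deriv η s * (∫ x, ⟪u s x, Ψ x⟫) + η s * F s)) +
        η 0 * (∫ x, ⟪u₀ x, Ψ x⟫) = 0 := fun η hη hηc hηT =>
    hu.test_smul_ae (hE.ae_memLp_and_kineticEnergy_le.mono fun s hs => hs.1) hΨ hΨdiv hη hηc hηT
  have hIoo : EqOn (fun t => ∫ x, ⟪u t x, Ψ x⟫) (fun t => (∫ x, ⟪u₀ x, Ψ x⟫) +
      ∫ s in Ioc 0 t, F s) (Ioo 0 T) := fun t ht =>
    FunctionSpaces.eq_add_setIntegral_of_forall_test hUint hFint (hcont.mono Ioo_subset_Icc_self) hid ht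
  have hR : ContinuousOn (fun t => (∫ x, ⟪u₀ x, Ψ x⟫) + ∫ s in Ioc 0 t, F s) (Icc 0 T) :=
    continuousOn_const.add (intervalIntegral.continuousOn_primitive hFint')
  have hIcc : EqOn (fun t => ∫ x, ⟪u t x, Ψ x⟫) (fun t => (∫ x, ⟪u₀ x, Ψ x⟫) +
      ∫ s in Ioc 0 t, F s) (Icc 0 T) :=
    hIoo.of_subset_closure hcont hR Ioo_subset_Icc_self (by rw [closure_Ioo hT.ne])
  exact hIcc ht

end Representative

end Fluid

end Literature.Analysis.FluidPDE
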